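/-
Copyright (c) 2026 the pub-hodgecm-mathlib formalisation cell (harness21).  Seat LD2-p01 (g5), ROAD O («orthogonal copy»): the organ-(R) CLOSER, 2026-09-02.
-/
import Summits.HodgeConjecture.HodgeConjecture.Theorems.F0LD1ThetaSpanPinDefs
import Summits.HodgeConjecture.HodgeConjecture.Theorems.F0LD1MeetsOfOrthogonalCopy
import HarnessLib

-- As in the lineage (★ `F0LD1ThetaRealisationOfB6`): statements over the theta-kernel datum elaborate to very large types; elaborate sequentially.
set_option Elab.async false

/-!
# Crux `HLiu418`, LD lines, ROAD O — ORGAN (R) `ThetaRealisation₂` (= LD2 organ A₂) FROM THE HODGE-FREE LETTER (A₂-P♮), (I′) AND THE UNITARY-CLASS PIN: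
# the printed realisation letter (B6) [Liu2021, Cor. B.6 (1)] = [Wu2013, Thm. 5.1] is BYPASSED for holomorphic `P` (orthogonal copy, [Liu2021, proof of Cor. B.6 (3)])

Cell hodgecm-mathlib (D-0151), FLOOR 0; crux item `HLiu418` = stmt-HodgeConjecture-24832; LD leaves `Cruxes/HLiu418/Lines/F0_P6LD_StubS1FactsThetaRoad.lean`
(organ (R) :298, socket `stub_letter_B6` :716) ∕ `…StubS1bFactsOrganRoad.lean` (organ A₂, `stub_letter_B6` :650).  Seat LD2-p01 (g5); chair LD1-plan (g3)
CLOSER SPEC 2026-09-02T13:12:07Z (c2).  THEOREMS ONLY (no `def`, no instance, no notation, no named fact, no `sorry`); `--supports stmt-HodgeConjecture-24832`.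

WHAT.  ★ `F0LD1ThetaRealisationOfB6.thetaRealisation₂_of_B6 (hAP) (hB6) (hIrr)` (p849456) closes organ (R) from THREE printed letters.  THIS FILE =
that theorem with
* `hAP` WEAKENED IN ITS HYPOTHESIS to the Hodge-free letter (A₂-P♮) `Liu2021.curveTheta_nonOrthogonal₂` (LA7-p01 (g7) statement file, body BY VALUE here:
  ★ `curveHolTheta_nonOrthogonal₂`'s body with the cone-frame binder `𝔣` and the `P.IsHolCotangentAt₂ … 𝔣` line deleted — [Liu2021, Thm. B.4 (1) (a)⇒(c)] is
  printed for an ARBITRARY cuspidal realisation; LD-ref1 LETTER AUDIT (n1), BOX ROAD-O #4),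
* `hB6` STRUCK and replaced by `hPin : F0LD1ThetaSpanPinDefs.ThetaSpanPin₂` — the UNITARY-CLASS PIN of theta spans (two non-zero closed theta spans both
  unitarily equivalent to the holomorphic `P` coincide; in print [Liu2021, Thm. B.4 (2)] «`W` unique up to isomorphism»; in house the PIN ASSEMBLY of LD1-p01),
* `hIrr` = (I′) `ThetaSpaceIrreducible₂` BY VALUE, unchanged;
conclusion = the organ (R) ∕ A₂ telescope VERBATIM.  Proof = ★ p849456's (pinned transport ★ `exists_adelicFrameTransport_smul`, compactness of `[U(H)]`, `hAP` at
`P`) with the junction (R-J′) replaced by ONE call of the ROAD O glue ★ `F0LD1MeetsOfOrthogonalCopy.meetsThetaLiftFromLine_of_starProjection_ne_zero_of_orthogonalCopy`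
(LD1-p01 (g5)): `hIrr` at every line, `hAP` at every discrete `P′` with the finite component `σ` (the glue's extra
unitary-equivalence binder is discarded — fork-neutral (g1)), `hPin` at `(P, a′)`.

HONEST SCOPE.  Nothing deep is proved here: the pole ⟹ theta step is the letter `hAP` (Hodge-free reading), the irreducibility of theta spans is (I′), the pin
is `hPin`.  For a HOLOMORPHIC `P` this BYPASSES (B6) — it does not prove (B6) (whose typed form quantifies over all discrete `P`).  Junk: every hypothesis is
consumed (`hsig`∕`hdef`∕`h4`∕`𝔣`∕`hhol`∕`hfin` feed `hAP`∕`hIrr`∕`hPin` verbatim).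
HONEST LABEL: HC_CM is proved only modulo the 7 printed citations (2 remaining: hLiu418 = stmt-HodgeConjecture-24832, h413 = stmt-HodgeConjecture-24833)
until rung 0 closes; this file discharges nothing printed by itself (kernel glue `(A₂-P♮) → (I′) → PIN → (R)`; count-neutral until an edition is BUILT).

## References
* [Liu2021] Y. Liu, Camb. J. Math. 9 (2021) = arXiv:2102.11518: App. B Thm. B.4 (1)(2) (p. 98), Cor. B.6 (1), (3) and proofs (p. 99 L43–67); proof of
  Prop. 4.13 Case 1 (p. 48); App. D proof of Prop. D.4 (1) (p. 130 L34 – p. 131 L21).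
* [Wu2013] C. Wu, J. Number Theory 133 (2013), Thm. 5.1, Thm. 5.3.  [DeitmarEchterhoff2014] Cor. 6.1.9.  [Dixmier1977] §5.4.
-/

set_option autoImplicit false
-- the mandated namespace has the single-problem summit's repeated segment (`HodgeConjecture.HodgeConjecture`)
set_option linter.dupNamespace false

noncomputable section

open NumberField NumberField.InfinitePlace MeasureTheory IsDedekindDomain
open scoped Matrix ComplexOrder ENNReal Classical

namespace Summit.HodgeConjecture.HodgeConjecture.Cruxes.HLiu418.F0LD1ThetaRealisationOfOrthogonalCopy

open Literature.RepresentationTheory.CompactGroups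
open _root_.MeasureTheory
open Literature.NumberTheory.Automorphic Literature.NumberTheory.Automorphic.UnitaryGroup
open Literature.NumberTheory.Automorphic.UnitaryGroup.CotangentForms
open Literature.NumberTheory.Automorphic.UnitaryCurveForms
open Literature.NumberTheory.Automorphic.IdeleClassGroup
open Literature.NumberTheory.Automorphic.Liu2021
open Literature.NumberTheory.Automorphic.Liu2021.Def411WeilCarriers
open Literature.NumberTheory.Automorphic.Liu2021.Def411WeilCarriersDoubling
open Literature.NumberTheory.GaloisRepresentations
open Literature.NumberTheory.GelbartRogawski1991 Literature.NumberTheory.GelbartRogawski1991.UnitaryDualPair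
open Literature.NumberTheory.Weil1964
open Literature.RepresentationTheory.Liu2021 Literature.RepresentationTheory.HarrisKudlaSweet1996
open Literature.NumberTheory.Rogawski1990
open Summit.HodgeConjecture.HodgeConjecture.Cruxes.HLiu418.F0LD1ThetaSpanPinDefs
open Summit.HodgeConjecture.HodgeConjecture.Cruxes.HLiu418.F0LD1MeetsOfOrthogonalCopy

set_option maxHeartbeats 2400000 in
-- (two letter bodies, the pin and the organ body are large binder telescopes; the proof is four named steps)
/-- **ORGAN (R) = A₂ `ThetaRealisation₂` FROM THE HODGE-FREE LETTER (A₂-P♮), (I′) AND THE UNITARY-CLASS PIN — (B6) BYPASSED for holomorphic `P`**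
([Liu2021, proof of Prop. 4.13 Case 1 ∕ proof of Cor. B.6 (3) with the second realisation chosen ORTHOGONAL to the theta span]): a discrete `P` of the CM unitary
curve `U(H)`, `H¹`-holomorphic at `ι` with θ-type finite component `σ ↪ ω(λ, ε_a, χ)_f`, MEETS the global theta lift from some hermitian line `⟨a′⟩` at the
splitting `λ`, along the pinned adelic transport `ιA` (which exists).  Hypotheses BY VALUE: `hAP` = (A₂-P♮) `Liu2021.curveTheta_nonOrthogonal₂` body
([Liu2021, Thm. B.4 (1)] for an arbitrary cuspidal realisation: non-orthogonality for EVERY discrete `P` with the finite component `σ`), `hIrr` = (I′)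
`ThetaSpaceIrreducible₂` body ([Liu2021, Cor. B.6 (1) first clause] = [Wu2013, Thm. 5.3]), `hPin : ThetaSpanPin₂` (the unitary-class pin, [Liu2021, Thm. B.4 (2)]);
conclusion = the LD1 organ (R) ∕ LD2 organ A₂ text VERBATIM (= ★ `thetaRealisation₂_of_B6`'s).  Proof: ★ `exists_adelicFrameTransport_smul`, compactness of
`[U(H)]`, `hAP` at `P`, ROAD O glue ★ `meetsThetaLiftFromLine_of_starProjection_ne_zero_of_orthogonalCopy`.
[cite: Liu2021, App. B Thm. B.4 (1)(2) (p. 98); Cor. B.6 (1), (3) and proofs (p. 99); proof of Prop. 4.13 Case 1 (p. 48); App. D proof of Prop. D.4 (1) (p. 131 L8–21)]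
[cite: Wu2013, Thm. 5.3] [cite: DeitmarEchterhoff2014, Cor. 6.1.9] -/
theorem thetaRealisation₂_of_orthogonalCopy
    (hAP :
      ∀ (L : Type) [Field L] [NumberField L] [IsCMField L] (ι : L →+* ℂ) (H : Matrix (Fin 2) (Fin 2) L)
        (dV : Fin 2 → L) (hdV : ∀ i, IsCMField.complexConj L (dV i) = dV i) (hdV0 : ∀ i, dV i ≠ 0)
        (t : L) (ht : t ≠ 0) (g : GL (Fin 2) L)
        (hg : formCongr ((IsCMField.complexConj L : L ≃ₐ[↥(maximalRealSubfield L)] L) : L →+* L) g (t • H) = Matrix.diagonal dV),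
        (∃ T : GL (Fin 2) ℂ, formCongr (starRingEnd ℂ) T ((Matrix.diagonal dV).map ι) = Matrix.diagonal ![(1 : ℂ), -1]) →
        (∀ τ' : L →+* ℂ, InfinitePlace.mk τ' ≠ InfinitePlace.mk ι → ((Matrix.diagonal dV).map τ').PosDef) →
        4 ≤ Module.finrank ℚ L →
        ∀ (μ : Measure (adelicGroupData (↥(maximalRealSubfield L)) L (IsCMField.complexConj L) 2 H).automorphicQuotient)
          [(adelicGroupData (↥(maximalRealSubfield L)) L (IsCMField.complexConj L) 2 H).IsAutomorphicMeasure μ]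
          {n' : ℕ} (e₁ : Fin 2 × Fin 1 ≃ Fin n')
          (lam : Literature.NumberTheory.Automorphic.IdeleClassGroup L →ₜ* Circle) (hlam : IsConjugateSymplectic L lam), HasWeight L lam 1 →
        ∀ (a : (↥(maximalRealSubfield L))ˣ) (χ : Chi (↥(maximalRealSubfield L)) L (IsCMField.complexConj L))
          (W : Type) [AddCommGroup W] [Module ℂ W]
          (σ : Representation ℂ (finAdelic (↥(maximalRealSubfield L)) L (IsCMField.complexConj L) 2 H) W),
          σ.IsIrreducible → σ.IsSmooth →
        ∀ j : σ.IntertwiningMap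
            ((rhoVAtLine (↥(maximalRealSubfield L)) L (IsCMField.complexConj L) 2 e₁ (Matrix.diagonal dV)
                (complexConj_imagUnit L) (imagUnit_ne_zero L) (imagUnit_mul_self L) (realDiagonal_isSymm L dV hdV)
                (isUnit_det_realDiagonal L dV hdV hdV0) (realDiagonal_map L dV hdV).symm
                (fun a => isCompatible_chiSplittingLine L e₁ dV hdV hdV0 (toHeckeCharacter L lam)
                  (isUnitary_toHeckeCharacter L lam) ((isOscillatorChar_toHeckeCharacter_iff lam).mpr hlam)
                  (TW (↥(maximalRealSubfield L)) a) (isSymm_TW (↥(maximalRealSubfield L)) a)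
                  (isUnit_det_TW (↥(maximalRealSubfield L)) a) (JW (↥(maximalRealSubfield L)) L a)
                  (JW_eq (↥(maximalRealSubfield L)) L a)) a χ).comp
              (finAdelicCongr (↥(maximalRealSubfield L)) L (IsCMField.complexConj L) g ht hg).symm.toMonoidHom),
          Function.Injective j →
        ∀ (ιA : (adelicGroupData (↥(maximalRealSubfield L)) L (IsCMField.complexConj L) 2 H).Adelic →*
            ↥(UnitaryGroup.adelic (↥(maximalRealSubfield L)) L (IsCMField.complexConj L) 2 (Matrix.diagonal dV))),
          (∀ k, ((ιA k : ↥(UnitaryGroup.adelic (↥(maximalRealSubfield L)) L (IsCMField.complexConj L) 2 (Matrix.diagonal dV))) :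
                GL (Fin 2) (AdeleRing (𝓞 L) L)) =
              (toAdeleGL L g)⁻¹ * adelicVal (↥(maximalRealSubfield L)) L (IsCMField.complexConj L) 2 H k * toAdeleGL L g) →
        ∀ [CompactSpace (↥(UnitaryGroup.adelic (↥(maximalRealSubfield L)) L (IsCMField.complexConj L) 2 (Matrix.diagonal dV)) ⧸
            (UnitaryGroup.toAdelic (↥(maximalRealSubfield L)) L (IsCMField.complexConj L) 2 (Matrix.diagonal dV)).range)]
          [CompactSpace (adelicGroupData (↥(maximalRealSubfield L)) L (IsCMField.complexConj L) 2 H).automorphicQuotient],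
        ∀ P : DiscreteAutomorphicRep (adelicGroupData (↥(maximalRealSubfield L)) L (IsCMField.complexConj L) 2 H) μ,
          P.HasFinComponent σ →
          ∃ a' : (↥(maximalRealSubfield L))ˣ,
            letI : MeasurableSpace (↥(UnitaryGroup.adelic (↥(maximalRealSubfield L)) L (IsCMField.complexConj L) 1 (JW (↥(maximalRealSubfield L)) L a')) ⧸
                (UnitaryGroup.toAdelic (↥(maximalRealSubfield L)) L (IsCMField.complexConj L) 1 (JW (↥(maximalRealSubfield L)) L a')).range) := borel _
            haveI := normal_range_toAdelic_JW L a'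
            ∃ (hρ : HasThetaMajorants fun
                (p : ↥(UnitaryGroup.adelic (↥(maximalRealSubfield L)) L (IsCMField.complexConj L) 2 (Matrix.diagonal dV)) ×
                  ↥(UnitaryGroup.adelic (↥(maximalRealSubfield L)) L (IsCMField.complexConj L) 1 (JW (↥(maximalRealSubfield L)) L a')))
                  (Φ : piSchwartzBruhat (↥(maximalRealSubfield L)) (Fin n')) =>
                  pairRep (↥(maximalRealSubfield L)) L (IsCMField.complexConj L) 2 1 e₁ (Matrix.diagonal dV) (JW (↥(maximalRealSubfield L)) L a')
                    (chiSplittingLine L e₁ dV hdV hdV0 (toHeckeCharacter L lam) (isUnitary_toHeckeCharacter L lam)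
                      ((isOscillatorChar_toHeckeCharacter_iff lam).mpr hlam) (TW (↥(maximalRealSubfield L)) a')
                      (isUnit_det_TW (↥(maximalRealSubfield L)) a') (JW (↥(maximalRealSubfield L)) L a') (JW_eq (↥(maximalRealSubfield L)) L a'))
                    p Φ)
              (μW : Measure (↥(UnitaryGroup.adelic (↥(maximalRealSubfield L)) L (IsCMField.complexConj L) 1 (JW (↥(maximalRealSubfield L)) L a')) ⧸
                (UnitaryGroup.toAdelic (↥(maximalRealSubfield L)) L (IsCMField.complexConj L) 1 (JW (↥(maximalRealSubfield L)) L a')).range))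
              (_ : IsFiniteMeasure μW)
              (_ : SMulInvariantMeasure ↥(UnitaryGroup.adelic (↥(maximalRealSubfield L)) L (IsCMField.complexConj L) 1 (JW (↥(maximalRealSubfield L)) L a'))
                (↥(UnitaryGroup.adelic (↥(maximalRealSubfield L)) L (IsCMField.complexConj L) 1 (JW (↥(maximalRealSubfield L)) L a')) ⧸
                  (UnitaryGroup.toAdelic (↥(maximalRealSubfield L)) L (IsCMField.complexConj L) 1 (JW (↥(maximalRealSubfield L)) L a')).range) μW)
              (f : C((↥(UnitaryGroup.adelic (↥(maximalRealSubfield L)) L (IsCMField.complexConj L) 1 (JW (↥(maximalRealSubfield L)) L a')) ⧸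
                (UnitaryGroup.toAdelic (↥(maximalRealSubfield L)) L (IsCMField.complexConj L) 1 (JW (↥(maximalRealSubfield L)) L a')).range), ℂ))
              (Φ : piSchwartzBruhat (↥(maximalRealSubfield L)) (Fin n'))
              (hθ : MemLp (toQuotFun (adelicGroupData (↥(maximalRealSubfield L)) L (IsCMField.complexConj L) 2 H) fun x =>
                (lineThetaKernelDatum L 2 e₁ dV hdV hdV0 lam hlam a' hρ).thetaLiftFun μW Φ f (ιA x)) 2 μ),
              P.space.toSubmodule.starProjection (MemLp.toLp _ hθ) ≠ 0)
    (hIrr :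
      ∀ (L : Type) [Field L] [NumberField L] [IsCMField L] (ι : L →+* ℂ) (H : Matrix (Fin 2) (Fin 2) L)
          (dV : Fin 2 → L) (hdV : ∀ i, IsCMField.complexConj L (dV i) = dV i) (hdV0 : ∀ i, dV i ≠ 0)
          (t : L) (ht : t ≠ 0) (g : GL (Fin 2) L)
          (_hg : formCongr ((IsCMField.complexConj L : L ≃ₐ[↥(maximalRealSubfield L)] L) : L →+* L) g (t • H) = Matrix.diagonal dV),
          (∃ T : GL (Fin 2) ℂ, formCongr (starRingEnd ℂ) T ((Matrix.diagonal dV).map ι) = Matrix.diagonal ![(1 : ℂ), -1]) →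
          (∀ τ' : L →+* ℂ, InfinitePlace.mk τ' ≠ InfinitePlace.mk ι → ((Matrix.diagonal dV).map τ').PosDef) →
          4 ≤ Module.finrank ℚ L →
          ∀ (μ : Measure (adelicGroupData (↥(maximalRealSubfield L)) L (IsCMField.complexConj L) 2 H).automorphicQuotient)
            [(adelicGroupData (↥(maximalRealSubfield L)) L (IsCMField.complexConj L) 2 H).IsAutomorphicMeasure μ]
            {n' : ℕ} (e₁ : Fin 2 × Fin 1 ≃ Fin n')
            (lam : Literature.NumberTheory.Automorphic.IdeleClassGroup L →ₜ* Circle) (hlam : IsConjugateSymplectic L lam), HasWeight L lam 1 →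
          ∀ (ιA : (adelicGroupData (↥(maximalRealSubfield L)) L (IsCMField.complexConj L) 2 H).Adelic →*
              ↥(UnitaryGroup.adelic (↥(maximalRealSubfield L)) L (IsCMField.complexConj L) 2 (Matrix.diagonal dV))),
            (∀ k, ((ιA k : ↥(UnitaryGroup.adelic (↥(maximalRealSubfield L)) L (IsCMField.complexConj L) 2 (Matrix.diagonal dV))) :
                  GL (Fin 2) (AdeleRing (𝓞 L) L)) =
                (toAdeleGL L g)⁻¹ * adelicVal (↥(maximalRealSubfield L)) L (IsCMField.complexConj L) 2 H k * toAdeleGL L g) →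
          ∀ [CompactSpace (↥(UnitaryGroup.adelic (↥(maximalRealSubfield L)) L (IsCMField.complexConj L) 2 (Matrix.diagonal dV)) ⧸
              (UnitaryGroup.toAdelic (↥(maximalRealSubfield L)) L (IsCMField.complexConj L) 2 (Matrix.diagonal dV)).range)],
          ∀ (a' : (↥(maximalRealSubfield L))ˣ)
            (ξ : haveI := normal_range_toAdelic_JW L a'
              PontryaginDual (↥(UnitaryGroup.adelic (↥(maximalRealSubfield L)) L (IsCMField.complexConj L) 1 (JW (↥(maximalRealSubfield L)) L a')) ⧸ (UnitaryGroup.toAdelic (↥(maximalRealSubfield L)) L (IsCMField.complexConj L) 1 (JW (↥(maximalRealSubfield L)) L a')).range)),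
            ThetaLiftFromLineIrreducible L 2 H e₁ dV hdV hdV0 ιA μ lam hlam a' ξ)
    (hPin : ThetaSpanPin₂) :
    ∀ (L : Type) [Field L] [NumberField L] [IsCMField L] (ι : L →+* ℂ) (H : Matrix (Fin 2) (Fin 2) L)
      (dV : Fin 2 → L) (hdV : ∀ i, IsCMField.complexConj L (dV i) = dV i) (hdV0 : ∀ i, dV i ≠ 0)
      (t : L) (ht : t ≠ 0) (g : GL (Fin 2) L)
      (hg : formCongr ((IsCMField.complexConj L : L ≃ₐ[↥(maximalRealSubfield L)] L) : L →+* L) g (t • H) = Matrix.diagonal dV),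
      (∃ T : GL (Fin 2) ℂ, formCongr (starRingEnd ℂ) T ((Matrix.diagonal dV).map ι) = Matrix.diagonal ![(1 : ℂ), -1]) →
      (∀ τ' : L →+* ℂ, InfinitePlace.mk τ' ≠ InfinitePlace.mk ι → ((Matrix.diagonal dV).map τ').PosDef) →
      4 ≤ Module.finrank ℚ L →
      ∀ (𝔣 : ConeFrame L H (cmPlace L ι))
        (μ : Measure (adelicGroupData (↥(maximalRealSubfield L)) L (IsCMField.complexConj L) 2 H).automorphicQuotient)
        [(adelicGroupData (↥(maximalRealSubfield L)) L (IsCMField.complexConj L) 2 H).IsAutomorphicMeasure μ]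
        {n' : ℕ} (e₁ : Fin 2 × Fin 1 ≃ Fin n')
        (lam : Literature.NumberTheory.Automorphic.IdeleClassGroup L →ₜ* Circle) (hlam : IsConjugateSymplectic L lam), HasWeight L lam 1 →
      ∀ (a : (↥(maximalRealSubfield L))ˣ) (χ : Chi (↥(maximalRealSubfield L)) L (IsCMField.complexConj L))
        (W : Type) [AddCommGroup W] [Module ℂ W]
        (σ : Representation ℂ (finAdelic (↥(maximalRealSubfield L)) L (IsCMField.complexConj L) 2 H) W),
        σ.IsIrreducible → σ.IsSmooth →
      ∀ j : σ.IntertwiningMap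
          ((rhoVAtLine (↥(maximalRealSubfield L)) L (IsCMField.complexConj L) 2 e₁ (Matrix.diagonal dV)
              (complexConj_imagUnit L) (imagUnit_ne_zero L) (imagUnit_mul_self L) (realDiagonal_isSymm L dV hdV)
              (isUnit_det_realDiagonal L dV hdV hdV0) (realDiagonal_map L dV hdV).symm
              (fun a => isCompatible_chiSplittingLine L e₁ dV hdV hdV0 (toHeckeCharacter L lam)
                (isUnitary_toHeckeCharacter L lam) ((isOscillatorChar_toHeckeCharacter_iff lam).mpr hlam)
                (TW (↥(maximalRealSubfield L)) a) (isSymm_TW (↥(maximalRealSubfield L)) a)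
                (isUnit_det_TW (↥(maximalRealSubfield L)) a) (JW (↥(maximalRealSubfield L)) L a)
                (JW_eq (↥(maximalRealSubfield L)) L a)) a χ).comp
            (finAdelicCongr (↥(maximalRealSubfield L)) L (IsCMField.complexConj L) g ht hg).symm.toMonoidHom),
        Function.Injective j →
      ∀ [CompactSpace (↥(UnitaryGroup.adelic (↥(maximalRealSubfield L)) L (IsCMField.complexConj L) 2 (Matrix.diagonal dV)) ⧸
          (UnitaryGroup.toAdelic (↥(maximalRealSubfield L)) L (IsCMField.complexConj L) 2 (Matrix.diagonal dV)).range)],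
      ∀ P : DiscreteAutomorphicRep (adelicGroupData (↥(maximalRealSubfield L)) L (IsCMField.complexConj L) 2 H) μ,
        P.IsHolCotangentAt₂ (IsCMField.complexConj_ne_one L) (UnitaryGroup.complexConj_smul_infinitePlace L) (cmPlace L ι) 𝔣 →
        P.HasFinComponent σ →
        ∃ (ιA : (adelicGroupData (↥(maximalRealSubfield L)) L (IsCMField.complexConj L) 2 H).Adelic →*
            ↥(UnitaryGroup.adelic (↥(maximalRealSubfield L)) L (IsCMField.complexConj L) 2 (Matrix.diagonal dV))),
          (∀ k, ((ιA k : ↥(UnitaryGroup.adelic (↥(maximalRealSubfield L)) L (IsCMField.complexConj L) 2 (Matrix.diagonal dV))) :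
                GL (Fin 2) (AdeleRing (𝓞 L) L)) =
              (toAdeleGL L g)⁻¹ * adelicVal (↥(maximalRealSubfield L)) L (IsCMField.complexConj L) 2 H k * toAdeleGL L g) ∧
          ∃ a' : (↥(maximalRealSubfield L))ˣ, MeetsThetaLiftFromLine L 2 H e₁ dV hdV hdV0 P lam hlam a' ιA := by
  intro L _ _ _ ι H dV hdV hdV0 t ht g hg hsig hdef h4 𝔣 μA _ n' e₁ lam hlam hw a χ W _ _ σ hσi hσs j hj _ P hhol hfin
  -- the pinned transport exists under the scaled frame
  obtain ⟨ιA, hpin⟩ := F0LD2ArchAdmissibleAssembly.exists_adelicFrameTransport_smul L 2 H dV t ht g hg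
  -- `[U(H)]` is compact
  haveI : CompactSpace (adelicGroupData (↥(maximalRealSubfield L)) L (IsCMField.complexConj L) 2 H).automorphicQuotient := by
    obtain ⟨τ, hτ⟩ := UnitaryGroup.exists_infinitePlace_ne L h4 ι
    exact UnitaryGroup.compactSpace_adelicGroupData_automorphicQuotient L 2 H
      (UnitaryGroup.anisotropic_of_formCongr_smul_eq_of_posDef L 2 H dV t ht g hg τ (hdef τ hτ))
  -- the Hodge-free letter at `P` itself: a line `a′` and a theta class with non-zero projection to `P`
  obtain ⟨a', hpr⟩ := hAP L ι H dV hdV hdV0 t ht g hg hsig hdef h4 μA e₁ lam hlam hw a χ W σ hσi hσs j hj ιA hpin P hfin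
  -- ROAD O glue: (I′) at every line, (A₂-P♮) at every discrete `P′` with the finite component `σ`, the pin at `(P, a′)`
  exact ⟨ιA, hpin, a', meetsThetaLiftFromLine_of_starProjection_ne_zero_of_orthogonalCopy L 2 H e₁ dV hdV hdV0 t ht g hg ιA hpin
    P lam hlam a' σ hfin
    (fun b ξ => hIrr L ι H dV hdV hdV0 t ht g hg hsig hdef h4 μA e₁ lam hlam hw ιA hpin b ξ)
    (fun P' hσ' _ => hAP L ι H dV hdV hdV0 t ht g hg hsig hdef h4 μA e₁ lam hlam hw a χ W σ hσi hσs j hj ιA hpin P' hσ')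
    (hPin L ι H dV hdV hdV0 t ht g hg hsig hdef h4 𝔣 μA e₁ lam hlam hw a χ W σ hσi hσs j hj ιA hpin P hhol hfin a') hpr⟩

end Summit.HodgeConjecture.HodgeConjecture.Cruxes.HLiu418.F0LD1ThetaRealisationOfOrthogonalCopy

end
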